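import Mathlib
import HarnessLib
import Summits.HubbardSuperconductivity.HubbardSuperconductivity.Theorems.KLProgrammeH10TwoPointLimitPerturbedCountThinExplicitBounds

/-!
# Route `KLProgramme` — the thirty smallness conditions of the THIN anchored count for the closed-form constants, part 2: conditions (19)–(30),
# the near-critical bracket, and the assembly `thin_small_constants_explicit` / `exists_thin_small_constants_explicit` (`κ = pcThinKappa B m`)

Cell gate-hubbard-kl, seat p3 g25; located #15 «(X).1-C-DOOR-SLOT», cure (γ) step 1 (pen (R535)(A)); sequel of `…PerturbedCountThinExplicitBounds`.

* §1 (19) `thin_mdiag_le`, (20) `thin_adiag_le`, (22) `thin_mg_le`, `thin_Z_le` (the near-critical bracket `Z ≤ Z_m`), (28) `thin_even2_le`, (29) `thin_W_lt`,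
  (30a) `thin_manti_le`, (30b) `thin_mg2_le`, `thin_Z_conds` ((23) (24) (25) (26) (27) (30c));
* §2 **`thin_small_constants_explicit`** — ALL thirty conditions of `exists_thin_small_constants` for the closed-form `τ λ η₀F e s` and EVERY
  `0 < κ ≤ pcThinKappa B m`; **`exists_thin_small_constants_explicit`** — `exists_thin_small_constants`'s conclusion with the extra conjunct `κ = pcThinKappa B m`.
So the perturbation size of the thin anchored count is a CLOSED-FORM function of the `BandBounds` fields and the margin (step 1 of cure (γ)); steps 2–4
(thread through `countPairs_thin_perturbed` → `anchoredSectorCount_thin_*` → `klThinCountC₃′`, numeric lower bound, re-key of (T3)'s chain) follow.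
Everything is PROVED; no definitions; nothing about the Hubbard model is asserted.  References: BGM 2006 Lemma 3.1 / App. A2–A3 [cite: BenfattoGiulianiMastropietro2006].
-/

noncomputable section

namespace Summit.HubbardSuperconductivity.HubbardSuperconductivity.Theorems.PerturbedFermiCurve

set_option linter.dupNamespace false -- summit = problem name (single-conjunct summit), D-0017

open Real Set
open Literature.MathematicalPhysics.QuantumLattice Literature.MathematicalPhysics.QuantumLattice.BandSectorCounting

variable {a b : ℝ}

/-! ## §1 The conditions (19)–(30), for every `0 ≤ κ ≤ κ_thin(m)` -/

section Conditions

variable (B : BandBounds a b) {m : ℝ} (hm : 0 < m) {κ : ℝ} (hκ0 : 0 ≤ κ) (hκ : κ ≤ pcThinKappa B m)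
include hm hκ0 hκ
/-- (19) `e + M_diag(κ)·(2e/h) ≤ s`. -/
theorem thin_mdiag_le : pcThinE B m + pcMdiag B κ * (2 * pcThinE B m / B.hmin) ≤ pcThinS B m := by
  have hDt := B.Dtmin_pos; have hh := B.hmin_pos
  obtain ⟨k1, kD2, -, -⟩ := thin_kappa_basic B hκ
  obtain ⟨hM0, hM⟩ := pcMdiag_le_bar B hκ0 k1 kD2
  obtain ⟨-, hSEb, -⟩ := pcbar_pos B
  have hE0 := (pcThinE_pos B hm).le
  obtain ⟨-, hE2, -⟩ := pcThinE_le B m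
  have h1 : pcThinE B m * (B.hmin + 20 * pcSEbar B) ≤ pcThinS B m * B.hmin := (le_div_iff₀ (by positivity)).mp hE2
  have h2 : pcMdiag B κ * (2 * pcThinE B m / B.hmin) ≤ 10 * pcSEbar B * (2 * pcThinE B m / B.hmin) :=
    mul_le_mul_of_nonneg_right hM (by positivity)
  have h3 : pcThinE B m + 10 * pcSEbar B * (2 * pcThinE B m / B.hmin) = pcThinE B m * (B.hmin + 20 * pcSEbar B) / B.hmin := by
    field_simp; ring
  have h4 : pcThinE B m * (B.hmin + 20 * pcSEbar B) / B.hmin ≤ pcThinS B m := by rw [div_le_iff₀ hh]; exact h1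
  linarith

/-- (20) `e + A_diag(κ,κ)·(2e/h) ≤ s`. -/
theorem thin_adiag_le : pcThinE B m + pcAdiag B κ κ * (2 * pcThinE B m / B.hmin) ≤ pcThinS B m := by
  have hDt := B.Dtmin_pos; have hh := B.hmin_pos
  obtain ⟨k1, kD2, -, -⟩ := thin_kappa_basic B hκ
  obtain ⟨hA0, hA⟩ := pcAdiag_le_bar B hκ0 k1 kD2
  obtain ⟨hAd, -⟩ := pcThin_slopes_pos B
  have hE0 := (pcThinE_pos B hm).le
  obtain ⟨-, -, hE3, -⟩ := pcThinE_le B m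
  have h1 : pcThinE B m * (B.hmin + 2 * pcAdiagBar B) ≤ pcThinS B m * B.hmin := (le_div_iff₀ (by positivity)).mp hE3
  have h2 : pcAdiag B κ κ * (2 * pcThinE B m / B.hmin) ≤ pcAdiagBar B * (2 * pcThinE B m / B.hmin) :=
    mul_le_mul_of_nonneg_right hA (by positivity)
  have h3 : pcThinE B m + pcAdiagBar B * (2 * pcThinE B m / B.hmin) = pcThinE B m * (B.hmin + 2 * pcAdiagBar B) / B.hmin := by
    field_simp
  have h4 : pcThinE B m * (B.hmin + 2 * pcAdiagBar B) / B.hmin ≤ pcThinS B m := by rw [div_le_iff₀ hh]; exact h1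
  linarith

/-- (22) `2λ + M_Γ(κ,κ)·τ ≤ e`. -/
theorem thin_mg_le : 2 * pcThinLam B m + pcMG B κ κ * pcThinTau B m ≤ pcThinE B m := by
  have hDt := B.Dtmin_pos
  obtain ⟨k1, kD2, -, -⟩ := thin_kappa_basic B hκ
  obtain ⟨hM0, hM⟩ := pcMG_le_bar B hκ0 k1 kD2
  obtain ⟨-, hMG, -⟩ := pcThin_slopes_pos B
  have hT0 := (pcThinTau_pos B hm).le
  obtain ⟨hL1, -⟩ := pcThinLam_le B m
  obtain ⟨-, -, -, hT4, -⟩ := pcThinTau_le B m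
  have h1 : pcThinTau B m * (2 * pcMGBar B) ≤ pcThinE B m := (le_div_iff₀ (by positivity)).mp hT4
  have h2 : pcMG B κ κ * pcThinTau B m ≤ pcMGBar B * pcThinTau B m := mul_le_mul_of_nonneg_right hM hT0
  linarith

/-- The near-critical bracket `Z = e/Dt + 2κ/Dt + s·C_g·ε₄(κ,κ;e/2,e)` is `≥ 0` and `≤ Z_m`. -/
theorem thin_Z_le : 0 ≤ pcThinE B m / B.Dtmin + 2 * κ / B.Dtmin + B.smax * (B.Cg * pcE4 B κ κ (pcThinE B m / 2) (pcThinE B m)) ∧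
    pcThinE B m / B.Dtmin + 2 * κ / B.Dtmin + B.smax * (B.Cg * pcE4 B κ κ (pcThinE B m / 2) (pcThinE B m)) ≤ pcThinZm B m := by
  have hDt := B.Dtmin_pos; have hs := B.smax_pos; have hCg := B.Cg_pos
  obtain ⟨k1, kD2, -, -⟩ := thin_kappa_basic B hκ
  obtain ⟨-, -, -, hDE, hDK, -⟩ := pcThin_slopes_pos B
  obtain ⟨-, -, -, -, -, he4s, -⟩ := pcbar_pos B
  have hE0 := (pcThinE_pos B hm).le
  have hE4 := pcE4_le_affine B hκ0 k1 kD2 (pcThinE B m / 2) (pcThinE B m)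
  have hE4_0 : 0 ≤ pcE4 B κ κ (pcThinE B m / 2) (pcThinE B m) := by
    obtain ⟨hCV0, hSE0, -⟩ := pc_pos B hκ0 (by linarith) hκ0
    unfold pcE4; positivity
  obtain ⟨-, -, -, hE4b, -⟩ := pcThinE_le B m
  obtain ⟨-, -, -, -, -, -, -, -, kZ, -⟩ := pcThinKappa_le B m
  have h1 : pcThinE B m * (2 * pcThinDE B) ≤ pcThinZm B m := (le_div_iff₀ (by positivity)).mp hE4b
  have h2 : κ * (2 * pcThinDK B) ≤ pcThinZm B m := (le_div_iff₀ (by positivity)).mp (hκ.trans kZ)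
  refine ⟨by positivity, ?_⟩
  have h3 : B.smax * (B.Cg * pcE4 B κ κ (pcThinE B m / 2) (pcThinE B m)) ≤
      B.smax * (B.Cg * (pcThinE B m / 2 / 2 + 2 * B.smax * (pcThinE B m / B.Dtmin) + κ * pcE4slope B)) :=
    mul_le_mul_of_nonneg_left (mul_le_mul_of_nonneg_left hE4 hCg.le) hs.le
  have hexp : pcThinE B m / B.Dtmin + 2 * κ / B.Dtmin + B.smax * (B.Cg * (pcThinE B m / 2 / 2 + 2 * B.smax * (pcThinE B m / B.Dtmin) + κ * pcE4slope B)) =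
      pcThinE B m * (2 * pcThinDE B) / 2 + κ * (2 * pcThinDK B) / 2 := by
    unfold pcThinDE pcThinDK; ring
  linarith

/-- (28) the second fold condition `pcEven(κ,κ,κ;e/2,2e,τ) ≤ h/2`. -/
theorem thin_even2_le : pcEven B κ κ κ (pcThinE B m / 2) (2 * pcThinE B m) (pcThinTau B m) ≤ B.hmin / 2 := by
  have hDt := B.Dtmin_pos; have hs := B.smax_pos; have hCg := B.Cg_pos; have hh := B.hmin_pos
  obtain ⟨k1, kD2, -, -⟩ := thin_kappa_basic B hκ
  obtain ⟨-, -, -, -, hAEb, -, -, heven, -⟩ := pcbar_pos B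
  have hT0 := (pcThinTau_pos B hm).le; have hE0 := (pcThinE_pos B hm).le
  have haff := pcEven_le_affine B hκ0 k1 kD2 (lam := pcThinE B m / 2) (η₀ := 2 * pcThinE B m) (τ := pcThinTau B m) (by positivity)
    (by positivity) hT0
  obtain ⟨-, -, -, -, hE5, hE6, hE7, -⟩ := pcThinE_le B m
  obtain ⟨-, hT2, hT3, -⟩ := pcThinTau_le B m
  obtain ⟨-, -, -, -, -, -, kE, -⟩ := pcThinKappa_le B m
  have h1 : pcThinE B m * (48 * pcAEbar B) ≤ B.hmin * B.Dtmin := (le_div_iff₀ (by positivity)).mp hE5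
  have h2 : pcThinE B m * (12 * pcAEbar B * B.smax * B.Cg) ≤ B.hmin := (le_div_iff₀ (by positivity)).mp hE6
  have h3 : pcThinE B m * (96 * pcAEbar B * B.smax ^ 2 * B.Cg) ≤ B.hmin * B.Dtmin := (le_div_iff₀ (by positivity)).mp hE7
  have h4 : pcThinTau B m * (20 * pcAEbar B * B.smax) ≤ B.hmin := (le_div_iff₀ (by positivity)).mp hT2
  have h5 : pcThinTau B m * (30 * pcAEbar B ^ 2 * B.smax * B.Cg) ≤ B.hmin := (le_div_iff₀ (by positivity)).mp hT3
  have h6 : κ * (12 * pcEvenSlope B) ≤ B.hmin := (le_div_iff₀ (by positivity)).mp (hκ.trans kE)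
  have e1 : 2 * pcAEbar B * (2 * pcThinE B m / B.Dtmin) ≤ B.hmin / 12 := by
    rw [show 2 * pcAEbar B * (2 * pcThinE B m / B.Dtmin) = (4 * pcAEbar B * pcThinE B m) / B.Dtmin by ring, div_le_iff₀ hDt]; nlinarith
  have e2 : 2 * pcAEbar B * (B.smax * (B.Cg * (pcThinE B m / 2))) ≤ B.hmin / 12 := by nlinarith
  have e3 : 2 * pcAEbar B * (B.smax * (B.Cg * (5 / 4 * pcAEbar B * pcThinTau B m))) ≤ B.hmin / 12 := by nlinarith
  have e4 : 2 * pcAEbar B * (B.smax * (B.Cg * (2 * B.smax * (2 * pcThinE B m / B.Dtmin)))) ≤ B.hmin / 12 := by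
    rw [show 2 * pcAEbar B * (B.smax * (B.Cg * (2 * B.smax * (2 * pcThinE B m / B.Dtmin)))) =
      (8 * pcAEbar B * B.smax ^ 2 * B.Cg * pcThinE B m) / B.Dtmin by ring, div_le_iff₀ hDt]; nlinarith
  have e5 : 2 * pcAEbar B * (B.smax * (pcThinTau B m / 2)) ≤ B.hmin / 20 := by nlinarith
  have hexp : 2 * pcAEbar B * (2 * pcThinE B m / B.Dtmin + B.smax * (B.Cg * (pcThinE B m / 2 + 5 / 4 * pcAEbar B * pcThinTau B m +
      2 * B.smax * (2 * pcThinE B m / B.Dtmin)) + pcThinTau B m / 2)) =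
      2 * pcAEbar B * (2 * pcThinE B m / B.Dtmin) + 2 * pcAEbar B * (B.smax * (B.Cg * (pcThinE B m / 2))) +
        2 * pcAEbar B * (B.smax * (B.Cg * (5 / 4 * pcAEbar B * pcThinTau B m))) +
        2 * pcAEbar B * (B.smax * (B.Cg * (2 * B.smax * (2 * pcThinE B m / B.Dtmin)))) + 2 * pcAEbar B * (B.smax * (pcThinTau B m / 2)) := by ring
  linarith

/-- (29) the second forward-window condition (strict):
`2(2e/Dt + 2κ/Dt + s(C_g ε₄(κ,κ; e + (4+κ)A_E τ/2, 2e) + τ/2)) < ρ²`. -/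
theorem thin_W_lt : 2 * (2 * pcThinE B m / B.Dtmin + 2 * κ / B.Dtmin +
      B.smax * (B.Cg * pcE4 B κ κ (2 * (pcThinE B m / 2) + (4 + κ) * pcAE B κ κ * pcThinTau B m / 2) (2 * pcThinE B m) + pcThinTau B m / 2)) <
    B.rhomin ^ 2 := by
  have hDt := B.Dtmin_pos; have hs := B.smax_pos; have hCg := B.Cg_pos; have hρ := B.rhomin_pos
  obtain ⟨k1, kD2, -, -⟩ := thin_kappa_basic B hκ
  obtain ⟨hAE0, hAEb⟩ := pcAE_le_bar B hκ0 k1 kD2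
  obtain ⟨-, -, -, -, hAEbar0, he4s, -⟩ := pcbar_pos B
  obtain ⟨-, -, -, -, hDK, hDW, hDT⟩ := pcThin_slopes_pos B
  have hT0 := (pcThinTau_pos B hm).le; have hE0 := (pcThinE_pos B hm).le
  set L := 2 * (pcThinE B m / 2) + (4 + κ) * pcAE B κ κ * pcThinTau B m / 2 with hL
  have hE4 := pcE4_le_affine B hκ0 k1 kD2 L (2 * pcThinE B m)
  have hLle : L / 2 ≤ pcThinE B m / 2 + 5 / 4 * pcAEbar B * pcThinTau B m := by
    rw [hL]
    have : (4 + κ) * pcAE B κ κ * pcThinTau B m ≤ 5 * pcAEbar B * pcThinTau B m := mul_le_mul_of_nonneg_right (by nlinarith) hT0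
    linarith
  obtain ⟨-, -, -, -, -, -, -, hE8⟩ := pcThinE_le B m
  obtain ⟨-, -, -, -, -, -, hT7⟩ := pcThinTau_le B m
  obtain ⟨-, -, -, -, -, -, -, -, -, kW⟩ := pcThinKappa_le B m
  have h1 : pcThinE B m * (8 * pcThinDW B) ≤ B.rhomin ^ 2 := (le_div_iff₀ (by positivity)).mp hE8
  have h2 : pcThinTau B m * (8 * pcThinDT B) ≤ B.rhomin ^ 2 := (le_div_iff₀ (by positivity)).mp hT7
  have h3 : κ * (8 * pcThinDK B) ≤ B.rhomin ^ 2 := (le_div_iff₀ (by positivity)).mp (hκ.trans kW)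
  have hin : B.smax * (B.Cg * pcE4 B κ κ L (2 * pcThinE B m) + pcThinTau B m / 2) ≤
      B.smax * (B.Cg * (pcThinE B m / 2 + 5 / 4 * pcAEbar B * pcThinTau B m + 2 * B.smax * (2 * pcThinE B m / B.Dtmin) + κ * pcE4slope B) +
        pcThinTau B m / 2) := by
    refine mul_le_mul_of_nonneg_left ?_ hs.le
    have : pcE4 B κ κ L (2 * pcThinE B m) ≤ pcThinE B m / 2 + 5 / 4 * pcAEbar B * pcThinTau B m + 2 * B.smax * (2 * pcThinE B m / B.Dtmin) +
        κ * pcE4slope B := by linarith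
    have := mul_le_mul_of_nonneg_left this hCg.le
    linarith
  have hexp : 2 * pcThinE B m / B.Dtmin + 2 * κ / B.Dtmin +
      B.smax * (B.Cg * (pcThinE B m / 2 + 5 / 4 * pcAEbar B * pcThinTau B m + 2 * B.smax * (2 * pcThinE B m / B.Dtmin) + κ * pcE4slope B) +
        pcThinTau B m / 2) = pcThinE B m * (8 * pcThinDW B) / 8 + pcThinTau B m * (8 * pcThinDT B) / 8 + κ * (8 * pcThinDK B) / 8 := by
    unfold pcThinDW pcThinDT pcThinDK; ring
  have hρ2 : 0 < B.rhomin ^ 2 := by positivity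
  linarith

/-- (30a) `M_anti(κ,κ)·τ² ≤ 2e/2`. -/
theorem thin_manti_le : pcManti B κ κ * pcThinTau B m ^ 2 ≤ 2 * pcThinE B m / 2 := by
  have hDt := B.Dtmin_pos
  obtain ⟨k1, kD2, -, -⟩ := thin_kappa_basic B hκ
  obtain ⟨hM0, hM⟩ := pcManti_le_bar B hκ0 k1 kD2
  obtain ⟨-, -, -, -, hAEbar0, -⟩ := pcbar_pos B
  have hT0 := (pcThinTau_pos B hm).le
  obtain ⟨hT1, -, -, -, hT5, -⟩ := pcThinTau_le B m
  have h1 : pcThinTau B m * (5 * pcAEbar B) ≤ 2 * pcThinE B m := (le_div_iff₀ (by positivity)).mp hT5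
  have hsq : pcThinTau B m ^ 2 ≤ pcThinTau B m := by nlinarith
  calc pcManti B κ κ * pcThinTau B m ^ 2 ≤ 5 / 2 * pcAEbar B * pcThinTau B m :=
        mul_le_mul hM hsq (by positivity) (by positivity)
    _ ≤ 2 * pcThinE B m / 2 := by linarith

/-- (30b) `M_Γ(κ,κ)·τ ≤ 2(e/2)`. -/
theorem thin_mg2_le : pcMG B κ κ * pcThinTau B m ≤ 2 * (pcThinE B m / 2) := by
  have h := thin_mg_le B hm hκ0 hκ
  have hL0 := (pcThinLam_pos B hm).le
  linarith

/-- The six conditions on the near-critical bracket `Z`: (23) `2Z < ρ²`, (24) `Z < 1/2`, (25) `πZ + 2K < 2π`, (26) `A_diag·(π(πZ/(√2 u))) ≤ s`,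
(27) `A_diag·(π(πZ/(√2 u)))² ≤ s`, (30c) `3 S_E τ < ρ² − 2Z`. -/
theorem thin_Z_conds :
    2 * ((pcThinE B m) / B.Dtmin + 2 * κ / B.Dtmin + B.smax * (B.Cg * pcE4 B κ κ ((pcThinE B m) / 2) (pcThinE B m))) < B.rhomin ^ 2 ∧ (pcThinE B m) / B.Dtmin + 2 * κ / B.Dtmin + B.smax * (B.Cg * pcE4 B κ κ ((pcThinE B m) / 2) (pcThinE B m)) < 1 / 2 ∧ π * ((pcThinE B m) / B.Dtmin + 2 * κ / B.Dtmin + B.smax * (B.Cg * pcE4 B κ κ ((pcThinE B m) / 2) (pcThinE B m))) + 2 * umklappRadius b < 2 * π ∧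
      pcAdiag B κ κ * (π * (π * ((pcThinE B m) / B.Dtmin + 2 * κ / B.Dtmin + B.smax * (B.Cg * pcE4 B κ κ ((pcThinE B m) / 2) (pcThinE B m))) / (Real.sqrt 2 * B.umin))) ≤ pcThinS B m ∧
      pcAdiag B κ κ * (π * (π * ((pcThinE B m) / B.Dtmin + 2 * κ / B.Dtmin + B.smax * (B.Cg * pcE4 B κ κ ((pcThinE B m) / 2) (pcThinE B m))) / (Real.sqrt 2 * B.umin))) ^ 2 ≤ pcThinS B m ∧
      3 * pcSE B κ * pcThinTau B m < B.rhomin ^ 2 - 2 * ((pcThinE B m) / B.Dtmin + 2 * κ / B.Dtmin + B.smax * (B.Cg * pcE4 B κ κ ((pcThinE B m) / 2) (pcThinE B m))) := by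
  have hDt := B.Dtmin_pos; have hρ := B.rhomin_pos; have hu := B.umin_pos; have hπ := Real.pi_pos
  obtain ⟨k1, kD2, -, -⟩ := thin_kappa_basic B hκ
  have hT0 := (pcThinTau_pos B hm).le
  obtain ⟨-, -, -, -, -, hT6, -⟩ := pcThinTau_le B m
  obtain ⟨hZρ, hZq, hZK, hZS, hZu⟩ := pcThinZm_le B m
  obtain ⟨hZ0, hZ⟩ := thin_Z_le B hm hκ0 hκ
  obtain ⟨hAd0, hAd⟩ := pcAdiag_le_bar B hκ0 k1 kD2
  obtain ⟨hSE0, hSEb⟩ := pcSE_le_bar B hκ0 k1 kD2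
  obtain ⟨hAdB, -⟩ := pcThin_slopes_pos B
  obtain ⟨-, hSEbar, -⟩ := pcbar_pos B
  have hs2 : 0 < Real.sqrt 2 := Real.sqrt_pos.2 (by norm_num)
  have hρ2 : 0 < B.rhomin ^ 2 := by positivity
  generalize hZdef : (pcThinE B m) / B.Dtmin + 2 * κ / B.Dtmin + B.smax * (B.Cg * pcE4 B κ κ ((pcThinE B m) / 2) (pcThinE B m)) = Z at hZ0 hZ ⊢
  have hZ1 : Z ≤ B.rhomin ^ 2 / 4 := hZ.trans hZρ
  have hZ2 : Z ≤ 1 / 4 := hZ.trans hZq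
  refine ⟨by linarith, by linarith, ?_, ?_, ?_, ?_⟩
  · have h1 : π * Z ≤ π * (1 - umklappRadius b / π) := mul_le_mul_of_nonneg_left (hZ.trans hZK) hπ.le
    have h2 : π * (1 - umklappRadius b / π) = π - umklappRadius b := by field_simp
    have hK : umklappRadius b < π := umklappRadius_lt_pi B.hb
    linarith
  · have h1 : Z * (pcAdiagBar B * π ^ 2) ≤ pcThinS B m * (Real.sqrt 2 * B.umin) := (le_div_iff₀ (by positivity)).mp (hZ.trans hZS)
    have h2 : pcAdiagBar B * (π * (π * Z / (Real.sqrt 2 * B.umin))) ≤ pcThinS B m := by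
      rw [show pcAdiagBar B * (π * (π * Z / (Real.sqrt 2 * B.umin))) = Z * (pcAdiagBar B * π ^ 2) / (Real.sqrt 2 * B.umin) by ring,
        div_le_iff₀ (by positivity)]
      exact h1
    exact (mul_le_mul_of_nonneg_right hAd (by positivity)).trans h2
  · have hq0 : 0 ≤ π * (π * Z / (Real.sqrt 2 * B.umin)) := by positivity
    have hq1 : π * (π * Z / (Real.sqrt 2 * B.umin)) ≤ 1 := by
      have h1 : Z * π ^ 2 ≤ Real.sqrt 2 * B.umin := by
        have := (le_div_iff₀ (by positivity : (0:ℝ) < π ^ 2)).mp (hZ.trans hZu); linarith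
      rw [show π * (π * Z / (Real.sqrt 2 * B.umin)) = Z * π ^ 2 / (Real.sqrt 2 * B.umin) by ring, div_le_one (by positivity)]
      exact h1
    have hsq : (π * (π * Z / (Real.sqrt 2 * B.umin))) ^ 2 ≤ π * (π * Z / (Real.sqrt 2 * B.umin)) := by
      rw [sq]; exact mul_le_of_le_one_right hq0 hq1
    have h1 : Z * (pcAdiagBar B * π ^ 2) ≤ pcThinS B m * (Real.sqrt 2 * B.umin) := (le_div_iff₀ (by positivity)).mp (hZ.trans hZS)
    have h2 : pcAdiagBar B * (π * (π * Z / (Real.sqrt 2 * B.umin))) ≤ pcThinS B m := by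
      rw [show pcAdiagBar B * (π * (π * Z / (Real.sqrt 2 * B.umin))) = Z * (pcAdiagBar B * π ^ 2) / (Real.sqrt 2 * B.umin) by ring,
        div_le_iff₀ (by positivity)]
      exact h1
    calc pcAdiag B κ κ * (π * (π * Z / (Real.sqrt 2 * B.umin))) ^ 2 ≤ pcAdiag B κ κ * (π * (π * Z / (Real.sqrt 2 * B.umin))) :=
          mul_le_mul_of_nonneg_left hsq hAd0
      _ ≤ pcAdiagBar B * (π * (π * Z / (Real.sqrt 2 * B.umin))) := mul_le_mul_of_nonneg_right hAd hq0
      _ ≤ pcThinS B m := h2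
  · have h1 : pcThinTau B m * (12 * pcSEbar B) ≤ B.rhomin ^ 2 := (le_div_iff₀ (by positivity)).mp hT6
    have h2 : 3 * pcSE B κ * pcThinTau B m ≤ 3 * pcSEbar B * pcThinTau B m :=
      mul_le_mul_of_nonneg_right (mul_le_mul_of_nonneg_left hSEb (by norm_num)) hT0
    have h3 : 3 * pcSEbar B * pcThinTau B m = pcThinTau B m * (12 * pcSEbar B) / 4 := by ring
    linarith

end Conditions

/-! ## §2 The assembly -/

/-- **THE SMALL CONSTANTS OF THE THIN ANCHORED COUNT, IN CLOSED FORM, FOR EVERY `0 < κ ≤ κ_thin(m)`**: the thirty smallness conditions of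
`exists_thin_small_constants` / `countPairs_thin_perturbed` hold with `τ = pcThinTau B m`, `λ = pcThinLam B m`, `η₀F = pcThinF B m`, `e = pcThinE B m`,
`s = pcThinS B m` — closed-form functions of the `BandBounds` fields and the margin `m` — and EVERY perturbation size `0 < κ ≤ pcThinKappa B m`.
[cite: BenfattoGiulianiMastropietro2006, Lemma 3.1 / App. A2–A3] -/
theorem thin_small_constants_explicit (B : BandBounds a b) {m : ℝ} (hm : 0 < m) {κ : ℝ} (hκ0 : 0 < κ) (hκ : κ ≤ pcThinKappa B m) :
    0 < κ ∧ κ < B.Dtmin ∧ κ ≤ (pcThinS B m) ∧ 0 < (pcThinS B m) ∧ (pcThinS B m) ≤ m ∧ 0 < (pcThinTau B m) ∧ (pcThinTau B m) < π ∧ 0 < (pcThinLam B m) ∧ 0 < (pcThinF B m) ∧ 0 < (pcThinE B m) ∧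
      (pcThinF B m) ≤ (pcThinS B m) ∧ (pcThinE B m) ≤ (pcThinS B m) ∧ 2 * (pcThinE B m) ≤ (pcThinS B m) ∧
      2 * (B.Cg * pcE4 B κ κ (pcThinLam B m) (pcThinF B m)) ≤ (pcThinTau B m) ∧
      pcOdd B κ κ κ (2 * (pcThinLam B m)) (pcThinF B m) (pcThinTau B m) ≤ B.hmin / 2 ∧
      κ * pcAE B κ κ ≤ B.hmin / 2 ∧
      pcEven B κ κ κ (pcThinLam B m) (pcThinF B m) (pcThinTau B m) ≤ B.hmin / 2 ∧
      pcDiag B κ κ κ (pcThinS B m) (pcThinS B m) ≤ 2 * B.hmin ∧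
      (pcThinE B m) + pcMdiag B κ * (2 * (pcThinE B m) / B.hmin) ≤ (pcThinS B m) ∧
      (pcThinE B m) + pcAdiag B κ κ * (2 * (pcThinE B m) / B.hmin) ≤ (pcThinS B m) ∧
      (pcThinE B m) ≤ 2 * B.hmin * (2 * (pcThinE B m) / B.hmin) / 4 ∧
      2 * (pcThinLam B m) + pcMG B κ κ * (pcThinTau B m) ≤ (pcThinE B m) ∧
      2 * ((pcThinE B m) / B.Dtmin + 2 * κ / B.Dtmin + B.smax * (B.Cg * pcE4 B κ κ ((pcThinE B m) / 2) (pcThinE B m))) < B.rhomin ^ 2 ∧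
      (pcThinE B m) / B.Dtmin + 2 * κ / B.Dtmin + B.smax * (B.Cg * pcE4 B κ κ ((pcThinE B m) / 2) (pcThinE B m)) < 1 / 2 ∧
      π * ((pcThinE B m) / B.Dtmin + 2 * κ / B.Dtmin + B.smax * (B.Cg * pcE4 B κ κ ((pcThinE B m) / 2) (pcThinE B m))) + 2 * umklappRadius b < 2 * π ∧
      pcAdiag B κ κ * (π * (π * ((pcThinE B m) / B.Dtmin + 2 * κ / B.Dtmin + B.smax * (B.Cg * pcE4 B κ κ ((pcThinE B m) / 2) (pcThinE B m))) / (Real.sqrt 2 * B.umin))) ≤ (pcThinS B m) ∧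
      pcAdiag B κ κ * (π * (π * ((pcThinE B m) / B.Dtmin + 2 * κ / B.Dtmin + B.smax * (B.Cg * pcE4 B κ κ ((pcThinE B m) / 2) (pcThinE B m))) / (Real.sqrt 2 * B.umin))) ^ 2 ≤ (pcThinS B m) ∧
      pcEven B κ κ κ ((pcThinE B m) / 2) (2 * (pcThinE B m)) (pcThinTau B m) ≤ B.hmin / 2 ∧
      2 * (2 * (pcThinE B m) / B.Dtmin + 2 * κ / B.Dtmin +
        B.smax * (B.Cg * pcE4 B κ κ (2 * ((pcThinE B m) / 2) + (4 + κ) * pcAE B κ κ * (pcThinTau B m) / 2) (2 * (pcThinE B m)) + (pcThinTau B m) / 2)) < B.rhomin ^ 2 ∧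
      pcManti B κ κ * (pcThinTau B m) ^ 2 ≤ 2 * (pcThinE B m) / 2 ∧
      pcMG B κ κ * (pcThinTau B m) ≤ 2 * ((pcThinE B m) / 2) ∧
      3 * pcSE B κ * (pcThinTau B m) < B.rhomin ^ 2 - 2 * ((pcThinE B m) / B.Dtmin + 2 * κ / B.Dtmin + B.smax * (B.Cg * pcE4 B κ κ ((pcThinE B m) / 2) (pcThinE B m))) := by
  have hh := B.hmin_pos
  obtain ⟨-, -, kD, kS⟩ := thin_kappa_basic B hκ
  have hS0 := pcThinS_pos B hm; have hE0 := pcThinE_pos B hm; have hT0 := pcThinTau_pos B hm; have hL0 := pcThinLam_pos B hm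
  have hF0 := pcThinF_pos B hm
  obtain ⟨hSm, -⟩ := pcThinS_le B m
  obtain ⟨hE1, -⟩ := pcThinE_le B m
  obtain ⟨hT1, -⟩ := pcThinTau_le B m
  obtain ⟨hF1, -⟩ := pcThinF_le B m
  obtain ⟨c23, c24, c25, c26, c27, c30⟩ := thin_Z_conds B hm hκ0.le hκ
  have hτπ : pcThinTau B m < π := by linarith [Real.pi_gt_three]
  have c21 : pcThinE B m ≤ 2 * B.hmin * (2 * pcThinE B m / B.hmin) / 4 := by
    have : 2 * B.hmin * (2 * pcThinE B m / B.hmin) / 4 = pcThinE B m := by field_simp; ring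
    rw [this]
  exact ⟨hκ0, kD, kS, hS0, hSm, hT0, hτπ, hL0, hF0, hE0, hF1, by linarith, by linarith, thin_cover_le B hm hκ0.le hκ, thin_odd_le B hm hκ0.le hκ,
    thin_kAE_le B hκ0.le hκ, thin_even_le B hm hκ0.le hκ, thin_diag_le B hm hκ0.le hκ, thin_mdiag_le B hm hκ0.le hκ, thin_adiag_le B hm hκ0.le hκ,
    c21, thin_mg_le B hm hκ0.le hκ, c23, c24, c25, c26, c27, thin_even2_le B hm hκ0.le hκ, thin_W_lt B hm hκ0.le hκ, thin_manti_le B hm hκ0.le hκ,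
    thin_mg2_le B hm hκ0.le hκ, c30⟩

/-- **`exists_thin_small_constants` WITH THE EXPLICIT PERTURBATION SIZE**: the constants of `exists_thin_small_constants` can be taken with
`κ = pcThinKappa B m` (and `τ λ η₀F e s` the closed forms above). [cite: BenfattoGiulianiMastropietro2006, Lemma 3.1 / App. A2–A3] -/
theorem exists_thin_small_constants_explicit (B : BandBounds a b) {m : ℝ} (hm : 0 < m) :
    ∃ κ τ lam f e s : ℝ, κ = pcThinKappa B m ∧ 0 < κ ∧ κ < B.Dtmin ∧ κ ≤ s ∧ 0 < s ∧ s ≤ m ∧ 0 < τ ∧ τ < π ∧ 0 < lam ∧ 0 < f ∧ 0 < e ∧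
      f ≤ s ∧ e ≤ s ∧ 2 * e ≤ s ∧
      2 * (B.Cg * pcE4 B κ κ lam f) ≤ τ ∧
      pcOdd B κ κ κ (2 * lam) f τ ≤ B.hmin / 2 ∧
      κ * pcAE B κ κ ≤ B.hmin / 2 ∧
      pcEven B κ κ κ lam f τ ≤ B.hmin / 2 ∧
      pcDiag B κ κ κ s s ≤ 2 * B.hmin ∧
      e + pcMdiag B κ * (2 * e / B.hmin) ≤ s ∧
      e + pcAdiag B κ κ * (2 * e / B.hmin) ≤ s ∧
      e ≤ 2 * B.hmin * (2 * e / B.hmin) / 4 ∧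
      2 * lam + pcMG B κ κ * τ ≤ e ∧
      2 * (e / B.Dtmin + 2 * κ / B.Dtmin + B.smax * (B.Cg * pcE4 B κ κ (e / 2) e)) < B.rhomin ^ 2 ∧
      e / B.Dtmin + 2 * κ / B.Dtmin + B.smax * (B.Cg * pcE4 B κ κ (e / 2) e) < 1 / 2 ∧
      π * (e / B.Dtmin + 2 * κ / B.Dtmin + B.smax * (B.Cg * pcE4 B κ κ (e / 2) e)) + 2 * umklappRadius b < 2 * π ∧
      pcAdiag B κ κ * (π * (π * (e / B.Dtmin + 2 * κ / B.Dtmin + B.smax * (B.Cg * pcE4 B κ κ (e / 2) e)) / (Real.sqrt 2 * B.umin))) ≤ s ∧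
      pcAdiag B κ κ * (π * (π * (e / B.Dtmin + 2 * κ / B.Dtmin + B.smax * (B.Cg * pcE4 B κ κ (e / 2) e)) / (Real.sqrt 2 * B.umin))) ^ 2 ≤ s ∧
      pcEven B κ κ κ (e / 2) (2 * e) τ ≤ B.hmin / 2 ∧
      2 * (2 * e / B.Dtmin + 2 * κ / B.Dtmin +
        B.smax * (B.Cg * pcE4 B κ κ (2 * (e / 2) + (4 + κ) * pcAE B κ κ * τ / 2) (2 * e) + τ / 2)) < B.rhomin ^ 2 ∧
      pcManti B κ κ * τ ^ 2 ≤ 2 * e / 2 ∧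
      pcMG B κ κ * τ ≤ 2 * (e / 2) ∧
      3 * pcSE B κ * τ < B.rhomin ^ 2 - 2 * (e / B.Dtmin + 2 * κ / B.Dtmin + B.smax * (B.Cg * pcE4 B κ κ (e / 2) e)) :=
  ⟨pcThinKappa B m, pcThinTau B m, pcThinLam B m, pcThinF B m, pcThinE B m, pcThinS B m, rfl,
    thin_small_constants_explicit B hm (pcThinKappa_pos B hm) le_rfl⟩

end Summit.HubbardSuperconductivity.HubbardSuperconductivity.Theorems.PerturbedFermiCurve

end
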